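import Mathlib.FieldTheory.Finite.GaloisField
import Mathlib.NumberTheory.LocalField.Basic
import Mathlib.Topology.Algebra.Group.ClosedSubgroup
import Literature.NumberTheory.GaloisRepresentations.LocalClassFieldTheory
import HarnessLib

/-!
# The existence theorem of local class field theory (Serre, *Local Fields*, XI §4–5, XIV §6)

Topic `NumberTheory/GaloisRepresentations` (trunk GalRep); namespace `Literature`.  Companion to
`Literature/NumberTheory/GaloisRepresentations/LocalClassFieldTheory.lean`, whose named fact
`Literature.NumberTheory.GaloisRepresentations.exists_intermediateField_normSubgroup_eq` (the existence theorem, Serre LF XIV §6 Thm. 1)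
this file (1) shows to have been **mis-stated as first vendored**, (2) restates correctly, and
(3) reduces — following Serre's printed proof — to six named sub-results of local class field
theory, each vendored here as a cited `def … : Prop`.

## 1. The trunk fact as first vendored was mis-stated (dropped instance hypotheses)

`exists_intermediateField_normSubgroup_eq` was vendored (M5 mechanical rewrite of a sorried
interim `theorem` into `def … : Prop`) under
`variable (F) [Field F] [ValuativeRel F] [TopologicalSpace F] [IsNonarchimedeanLocalField F]`,
but as a `def` whose body mentions neither the valuative structure nor the local-field class,
Lean omitted those section variables: the constant elaborated to
`(F : Type u) → [Field F] → [TopologicalSpace F] → Prop`, i.e. it asserted the existence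
theorem for *every field with every topology*.  That literal statement — written out in full
in `not_forall_exists_intermediateField_normSubgroup_eq` below, so that the refutation does not
depend on the trunk constant and survives its repair — is false: take `F = 𝔽₃` with the
discrete topology and `U = ⊥` (norms from finite extensions of finite fields are surjective,
`FiniteField.unitsMap_norm_surjective`).  (For a sorried `theorem` Lean *does* include such
section instances; the theorem → `def` rewrite changed the statement.  Any other named fact
produced that way whose body does not use an ambient instance hypothesis has the same defect.)

The corrected statement is `localExistenceTheorem F`, with the local-field hypotheses as
explicit binders; the trunk def is given the same explicit binders by the defact clean-up of
`LocalClassFieldTheory.lean` (2026-08-15).  In either form the trunk predicate at a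
non-archimedean local field `F` is *definitionally* `localExistenceTheorem F`
(`localExistenceTheorem_iff`), so users holding `(h : exists_intermediateField_normSubgroup_eq F)`
for a local `F` lose nothing, and the two names denote one statement.

## 2. Serre's proof, and the decomposition vendored here

Serre LF XIV §6 Thm. 1 (p. 218): for `K` complete, discretely valued, with *finite* residue
field, every closed subgroup of finite index of `K*` is a norm group `N_{L/K} L*` of a finite
abelian `L/K`; Cor. 1: for finite-index subgroups, norm group ⟺ open ⟺ closed.  The printed
proof applies the abstract existence theorem XI §5 Thm. 2 (p. 174) to the class formation of
XIII §4 after checking axioms III-1 (the norm is proper), III-2 (universal norms are `p`-th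
powers: XIV §2 Cor. to Prop. 7 via the Hilbert symbol for `p ≠ char K`, XIV §5 Prop. 16 via the
Artin–Schreier symbol for `p = char K`) and III-3 (finite-index subgroups containing the units
are norm groups of unramified extensions, XIII §4 Prop. 13 / V §2 Prop. 3).  The proof of
XI §5 Thm. 2 itself uses XI §4 Prop. 4 (norm groups are stable under intersection and under
passing to over-groups — this rests on the reciprocity isomorphism `K*/NL* ≅ G(L/K)`, Tate's
theorem XI §3 / XIII §4 Cor. to Prop. 8), XI §4 Cor. to Prop. 3 (norm groups have finite
index), XI §5 Prop. 6 (the universal norm group is divisible and equals `⋂ₙ (K*)ⁿ`) and a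
compactness argument in `K*`.

Accordingly this file vendors, for a non-archimedean local field `F` and with
`IsNormSubgroup F U` := "`U = N_{E/F} Eˣ` for some finite abelian `E ⊆ F̄`":
* `isNormSubgroup_inf`            — XI §4 Prop. 4 (`I_{F·F'} = I_F ∩ I_{F'}`);
* `isNormSubgroup_of_le`          — XI §4 Prop. 4, last assertion;
* `index_normSubgroup_eq_finrank` — XI §4 Cor. to Prop. 3 = XIII §4 Cor. to Prop. 8 / Prop. 9;
* `universalNormSubgroup_divisible_and_eq` — XI §5 Prop. 6 (with XIV §6, axioms III-1, III-2);
* `isClosed_of_isNormSubgroup`    — XIV §6, axiom III-1 (the norm map is proper);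
* `isNormSubgroup_of_unitGroup_le` — XIV §6, axiom III-3 (XIII §4 Prop. 13, V §2 Prop. 3);
and PROVES the assembly `localExistenceTheorem_of` (Serre's proof of XI §5 Thm. 2, specialised
to `A_F = Fˣ`, `U_F = 𝒪ˣ`, using compactness of `𝒪ˣ` in `Fˣ`, `isCompact_unitGroup`), hence
`exists_intermediateField_normSubgroup_eq_of`.  Discharging the six facts is the remaining
(large) work: the first four need the reciprocity isomorphism (Brauer group of a local field,
Tate's theorem) and the symbol computations; the last two are elementary but not small.

## Mathlib search

Mathlib (pin v4.32.0) has `IsNonarchimedeanLocalField` (locally compact, `CompactSpace 𝒪[K]`,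
finite residue field), `ValuationSubring.unitGroup`, `Subgroup.isOpen_of_isClosed_of_finiteIndex`,
`IsCompact.elim_finite_subfamily_closed`, `FiniteField.unitsMap_norm_surjective`,
`IsAbelianGalois`; it has no norm groups, no reciprocity map, no Brauer groups of local fields,
no Lubin–Tate theory (`rg -i "norm group|reciprocity map|LubinTate|class formation"`: no hits).

## References

* J.-P. Serre, *Local Fields*, GTM 67, Springer 1979 (transl. M. J. Greenberg): Ch. XI §4
  (Prop. 3, Cor., Prop. 4; pp. 172–173), §5 (Prop. 5, Prop. 6, Thm. 2; pp. 173–175), Ch. XIII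
  §4 (Thm. 1, Prop. 8 and Cor., Prop. 9, Prop. 13; pp. 195–198), Ch. XIV §6 (Thm. 1, Cor. 1,
  Cor. 2; pp. 218–219).  [SerreLocalFields1979]
-/

noncomputable section

open ValuativeRel

namespace Literature.NumberTheory.GaloisRepresentations

/-! ### 1. The statement without local-field hypotheses is false; the corrected statement -/

/-- The existence statement **without** local-field hypotheses is false.  Written out literally,
this is what the trunk constant `exists_intermediateField_normSubgroup_eq` elaborated to as first
vendored (binders `(F) [Field F] [TopologicalSpace F]` only — its hypotheses
`[ValuativeRel F] [IsNonarchimedeanLocalField F]` were unused section variables and were dropped by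
Lean): "for every field `F` with every topology, every open subgroup of finite index of `Fˣ` is
the norm group of a finite abelian `E ⊆ F̄`".  Counterexample: `F = 𝔽₃` with the discrete
topology, `U = ⊥ ≤ 𝔽₃ˣ` is open of finite index, but every finite extension `E/𝔽₃` has
`N_{E/𝔽₃}(Eˣ) = 𝔽₃ˣ ≠ ⊥` (surjectivity of the norm for finite fields,
`FiniteField.unitsMap_norm_surjective`). [folklore] -/
theorem not_forall_exists_intermediateField_normSubgroup_eq :
    ¬ ∀ (F : Type) [Field F] [TopologicalSpace F] (U : Subgroup Fˣ), IsOpen (U : Set Fˣ) →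
      U.FiniteIndex → ∃ E : IntermediateField F (AlgebraicClosure F),
        FiniteDimensional F E ∧ IsAbelianGalois F E ∧
          (Units.map (Algebra.norm F : E →* F)).range = U := by
  intro h
  letI : TopologicalSpace (ZMod 3) := ⊥
  haveI : DiscreteTopology (ZMod 3) := ⟨rfl⟩
  obtain ⟨E, hfd, -, hE⟩ :=
    h (ZMod 3) (⊥ : Subgroup (ZMod 3)ˣ) (isOpen_discrete _) inferInstance
  haveI : Finite E := Module.finite_of_finite (ZMod 3)
  have hsurj := FiniteField.unitsMap_norm_surjective (ZMod 3) E
  have htop : (⊤ : Subgroup (ZMod 3)ˣ) = ⊥ := by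
    rw [← MonoidHom.range_eq_top.mpr hsurj, hE]
  have hmem : (-1 : (ZMod 3)ˣ) ∈ (⊥ : Subgroup (ZMod 3)ˣ) := htop ▸ Subgroup.mem_top _
  rw [Subgroup.mem_bot] at hmem
  exact absurd hmem (by decide)

/-- **Existence theorem of local class field theory** (the trunk fact
`exists_intermediateField_normSubgroup_eq` stated with its local-field hypotheses
`[ValuativeRel F] [IsNonarchimedeanLocalField F]` as explicit binders — as first vendored the
trunk constant had lost them, see the module docstring and
`not_forall_exists_intermediateField_normSubgroup_eq`; the two names denote one statement,
`localExistenceTheorem_iff`).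
For a non-archimedean local field `F`, every open subgroup of finite index `U ≤ Fˣ` is a norm
group: there is a finite abelian Galois extension `E/F` inside `F̄` with `N_{E/F}(Eˣ) = U`.
Serre states it for `K` complete under a discrete valuation with finite residue field and for
*closed* subgroups of finite index (Thm. 1), noting (Cor. 1) that for finite-index subgroups
closed ⟺ open ⟺ `⊇ U_K^{(n)}` for some `n`; uniqueness of `E` (XI §4 Prop. 4) is not asserted.
Ref: Serre, *Local Fields* (1979), Ch. XIV §6, Thm. 1 and Cor. 1 (p. 218).
[cite: SerreLocalFields1979, Ch. XIV §6 Thm. 1] -/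
def localExistenceTheorem (F : Type*) [Field F] [ValuativeRel F] [TopologicalSpace F]
    [IsNonarchimedeanLocalField F] : Prop :=
  ∀ (U : Subgroup Fˣ), IsOpen (U : Set Fˣ) → U.FiniteIndex →
    ∃ E : IntermediateField F (AlgebraicClosure F), FiniteDimensional F E ∧ IsAbelianGalois F E ∧
      (Units.map (Algebra.norm F : E →* F)).range = U

section

variable (F : Type*) [Field F] [ValuativeRel F] [TopologicalSpace F] [IsNonarchimedeanLocalField F]

/-- On a non-archimedean local field the corrected statement *is* the trunk predicate
(definitionally: one statement under two names), so `(h : exists_intermediateField_normSubgroup_eq F)`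
for a local `F` is fed by any proof of `localExistenceTheorem F`. [folklore] -/
theorem localExistenceTheorem_iff :
    localExistenceTheorem F ↔ exists_intermediateField_normSubgroup_eq F :=
  Iff.rfl

end

/-! ### 2. Norm groups -/

/-- A subgroup `U ≤ Fˣ` **is a norm group** if `U = N_{E/F}(Eˣ)` for some finite abelian Galois
extension `E/F` inside the algebraic closure `F̄` (the image of `Eˣ` under `Units.map` of
`Algebra.norm F : E →* F`).  Serre (XI §4, Definition) allows any finite extension of the
formation; by norm limitation (XI §4 Prop. 3, `N_{E'/E} A_{E'} = N_{E''/E} A_{E''}` with `E''`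
the maximal abelian subextension) this gives the same subgroups, and XIV §6 Thm. 1 is phrased
with abelian `L/K`.  The definition makes sense for any field.
Ref: Serre, *Local Fields* (1979), Ch. XI §4, Definition and Prop. 3 (p. 172).
[cite: SerreLocalFields1979, Ch. XI §4 Definition] -/
def IsNormSubgroup (F : Type*) [Field F] (U : Subgroup Fˣ) : Prop :=
  ∃ E : IntermediateField F (AlgebraicClosure F), FiniteDimensional F E ∧ IsAbelianGalois F E ∧
    (Units.map (Algebra.norm F : E →* F)).range = U

/-- The **group of universal norms** `D_F = ⋂_E N_{E/F}(Eˣ)` (intersection of all norm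
groups).  Ref: Serre, *Local Fields* (1979), Ch. XI §5, Definition (p. 174).
[cite: SerreLocalFields1979, Ch. XI §5 Definition] -/
def universalNormSubgroup (F : Type*) [Field F] : Subgroup Fˣ :=
  ⨅ (U : Subgroup Fˣ) (_ : IsNormSubgroup F U), U

section NormSubgroup

variable (F : Type*) [Field F]

/-- Unfolding `IsNormSubgroup`. [folklore] -/
theorem isNormSubgroup_iff (U : Subgroup Fˣ) :
    IsNormSubgroup F U ↔ ∃ E : IntermediateField F (AlgebraicClosure F),
      FiniteDimensional F E ∧ IsAbelianGalois F E ∧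
        (Units.map (Algebra.norm F : E →* F)).range = U :=
  Iff.rfl

/-- The norm group of `E ⊆ F̄` (finite abelian over `F`) is a norm group. [folklore] -/
theorem isNormSubgroup_range (E : IntermediateField F (AlgebraicClosure F))
    [FiniteDimensional F E] [IsAbelianGalois F E] :
    IsNormSubgroup F (Units.map (Algebra.norm F : E →* F)).range :=
  ⟨E, ‹_›, ‹_›, rfl⟩

/-- `Fˣ` itself is a norm group (`E = F`, i.e. `⊥ ≤ F̄`: `N_{F/F} = id`). [folklore] -/
theorem isNormSubgroup_top : IsNormSubgroup F ⊤ := by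
  refine ⟨⊥, inferInstance, inferInstance, ?_⟩
  rw [eq_top_iff]
  intro u _
  refine ⟨Units.map (algebraMap F (⊥ : IntermediateField F (AlgebraicClosure F))).toMonoidHom u,
    ?_⟩
  ext
  simp [Algebra.norm_algebraMap, IntermediateField.finrank_bot]

/-- Universal norms lie in every norm group. [folklore] -/
theorem universalNormSubgroup_le {U : Subgroup Fˣ} (hU : IsNormSubgroup F U) :
    universalNormSubgroup F ≤ U :=
  (iInf_le _ U).trans (iInf_le _ hU)

/-- Membership in the universal norm group. [folklore] -/
theorem mem_universalNormSubgroup_iff (x : Fˣ) :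
    x ∈ universalNormSubgroup F ↔ ∀ U : Subgroup Fˣ, IsNormSubgroup F U → x ∈ U := by
  simp only [universalNormSubgroup, Subgroup.mem_iInf]

end NormSubgroup

section

variable (F : Type*) [Field F] [ValuativeRel F] [TopologicalSpace F] [IsNonarchimedeanLocalField F]

/-- `localExistenceTheorem F` says exactly: every open finite-index subgroup of `Fˣ` is a norm
group. [folklore] -/
theorem localExistenceTheorem_iff_isNormSubgroup :
    localExistenceTheorem F ↔
      ∀ U : Subgroup Fˣ, IsOpen (U : Set Fˣ) → U.FiniteIndex → IsNormSubgroup F U :=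
  Iff.rfl

end

/-! ### 3. Serre's sub-results, vendored as named facts -/

/-- **Norm groups are stable under intersection** (Serre LF XI §4 Prop. 4: for abelian `F, F'`
over `E`, `F·F'` is abelian and `I_{F·F'} = I_F ∩ I_{F'}` where `I_F = N_{F/E} A_F`; here for
the class formation of a local field, XIII §4 Thm. 1, so `A_E = E*`).  Stated as the consequence
used in the existence theorem: the intersection of two norm groups of `Fˣ` is a norm group.  The
printed proof uses the reciprocity isomorphism `E*/N F* ≅ G(F/E)` (XIII §4, Cor. to Prop. 8).
Ref: Serre, *Local Fields* (1979), Ch. XI §4, Prop. 4 (p. 172), with Ch. XIII §4 Thm. 1.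
[cite: SerreLocalFields1979, Ch. XI §4 Prop. 4] -/
def isNormSubgroup_inf (F : Type*) [Field F] [ValuativeRel F] [TopologicalSpace F]
    [IsNonarchimedeanLocalField F] : Prop :=
  ∀ U V : Subgroup Fˣ, IsNormSubgroup F U → IsNormSubgroup F V → IsNormSubgroup F (U ⊓ V)

/-- **Every subgroup containing a norm group is a norm group** (Serre LF XI §4 Prop. 4, last
assertion, for the class formation of a local field, XIII §4 Thm. 1): if `N_{E/F}(Eˣ) ≤ V ≤ Fˣ`
with `E/F` finite abelian then `V = N_{E'/F}(E'ˣ)` for a finite abelian `E'` (namely the fixed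
field of the image of `V` under the reciprocity map).
Ref: Serre, *Local Fields* (1979), Ch. XI §4, Prop. 4 (p. 172), with Ch. XIII §4 Thm. 1.
[cite: SerreLocalFields1979, Ch. XI §4 Prop. 4] -/
def isNormSubgroup_of_le (F : Type*) [Field F] [ValuativeRel F] [TopologicalSpace F]
    [IsNonarchimedeanLocalField F] : Prop :=
  ∀ U V : Subgroup Fˣ, IsNormSubgroup F U → U ≤ V → IsNormSubgroup F V

/-- **The norm index equals the degree for abelian extensions** (Serre LF XI §4, Cor. to
Prop. 3: `(A_E : N_{E'/E} A_{E'})` is finite, divides `[E' : E]`, with equality iff `E'/E` is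
abelian; for local fields XIII §4, Cor. to Prop. 8 and Prop. 9: `(E* : N F*) = [F : E]` for
`F/E` abelian — the "fundamental equality", a consequence of the reciprocity isomorphism).
Stated for finite abelian `E ⊆ F̄` over a non-archimedean local field `F`:
`[Fˣ : N_{E/F}(Eˣ)] = [E : F]`.
Ref: Serre, *Local Fields* (1979), Ch. XI §4, Cor. to Prop. 3 (p. 172); Ch. XIII §4, Cor. to
Prop. 8 and Prop. 9 (pp. 196–197). [cite: SerreLocalFields1979, Ch. XIII §4 Prop. 9] -/
def index_normSubgroup_eq_finrank (F : Type*) [Field F] [ValuativeRel F] [TopologicalSpace F]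
    [IsNonarchimedeanLocalField F] : Prop :=
  ∀ E : IntermediateField F (AlgebraicClosure F), FiniteDimensional F E → IsAbelianGalois F E →
    (Units.map (Algebra.norm F : E →* F)).range.index = Module.finrank F E

/-- **The universal norm group is divisible and equals `⋂ₙ (Fˣ)ⁿ`** (Serre LF XI §5 Prop. 6:
"for every field `E`, the group `D_E` is divisible and equal to `⋂ n·A_E`", valid in a class
formation satisfying axioms III-1 and III-2; these are verified for the class formation of a
local field with finite residue field in XIV §6 — III-2 via the Hilbert symbol, XIV §2 Cor. to
Prop. 7, for `p ≠ char`, and via the Artin–Schreier symbol `[a, b)`, XIV §5 Prop. 16, for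
`p = char`).  Here `D_F = universalNormSubgroup F` and `n·A_E` is written multiplicatively as
the range of `powMonoidHom n` on `Fˣ`, `n ≥ 1`.
Ref: Serre, *Local Fields* (1979), Ch. XI §5, Prop. 6 (p. 174), with Ch. XIV §6 (proof of
Thm. 1, axioms III-1, III-2; pp. 218–219). [cite: SerreLocalFields1979, Ch. XI §5 Prop. 6] -/
def universalNormSubgroup_divisible_and_eq (F : Type*) [Field F] [ValuativeRel F]
    [TopologicalSpace F] [IsNonarchimedeanLocalField F] : Prop :=
  (∀ n : ℕ, 0 < n → ∀ x ∈ universalNormSubgroup F, ∃ y ∈ universalNormSubgroup F, y ^ n = x) ∧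
    universalNormSubgroup F = ⨅ (n : ℕ) (_ : 0 < n), (powMonoidHom n : Fˣ →* Fˣ).range

/-- **Norm groups are closed** (Serre LF XIV §6, proof of Thm. 1, axiom III-1: for every
finite extension `F/E` of local fields the norm `N_{F/E} : F* → E*` is proper — every compact of
`E*` lies in finitely many translates of `U_E` and `N⁻¹(U_E) = U_F` is compact — hence, XI §5
remark after axiom III-1, has closed image).  Stated as the consequence used: every norm group
of `Fˣ` is closed (for the topology of `Fˣ` induced from `F`, `Units.instTopologicalSpace`).
Ref: Serre, *Local Fields* (1979), Ch. XIV §6, proof of Thm. 1, III-1 (p. 218); Ch. XI §5,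
axiom III-1 (p. 173). [cite: SerreLocalFields1979, Ch. XIV §6 Thm. 1 (proof, axiom III-1)] -/
def isClosed_of_isNormSubgroup (F : Type*) [Field F] [ValuativeRel F] [TopologicalSpace F]
    [IsNonarchimedeanLocalField F] : Prop :=
  ∀ U : Subgroup Fˣ, IsNormSubgroup F U → IsClosed (U : Set Fˣ)

/-- **Closed finite-index subgroups containing the units are norm groups** (Serre LF XIV §6,
proof of Thm. 1, axiom III-3 with `U_E` = the group of units: the finite-index subgroups of
`E*` containing `U_E` are the `v_E⁻¹(nℤ)`, which are the norm groups of the unramified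
extensions of degree `n`, by XIII §4 Prop. 13, or V §2 Prop. 3).  Here the units of `F` are
`(valuation F).valuationSubring.unitGroup ≤ Fˣ` (membership: `valuation F u = 1`).
Ref: Serre, *Local Fields* (1979), Ch. XIV §6, proof of Thm. 1, III-3 (p. 219); Ch. XIII §4,
Prop. 13 (p. 197); Ch. V §2, Prop. 3.
[cite: SerreLocalFields1979, Ch. XIV §6 Thm. 1 (proof, axiom III-3)] -/
def isNormSubgroup_of_unitGroup_le (F : Type*) [Field F] [ValuativeRel F] [TopologicalSpace F]
    [IsNonarchimedeanLocalField F] : Prop :=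
  ∀ U : Subgroup Fˣ, IsClosed (U : Set Fˣ) → U.FiniteIndex →
    (valuation F).valuationSubring.unitGroup ≤ U → IsNormSubgroup F U

/-! ### 4. The assembly (Serre's proof of XI §5 Thm. 2, specialised to `Fˣ`) -/

section Assembly

variable (F : Type*) [Field F] [ValuativeRel F] [TopologicalSpace F] [IsNonarchimedeanLocalField F]

/-- The unit group `𝒪ˣ = {u : valuation F u = 1} ≤ Fˣ` of a non-archimedean local field is
compact (for the topology of `Fˣ`): it is the preimage under the embedding `Fˣ ↪ F` of the unit
sphere, a closed subset of the compact closed unit ball `𝒪[F]`.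
Ref: Serre, *Local Fields* (1979), Ch. II §1, Prop. 1 (local compactness ⟹ `U_K` compact).
[folklore] -/
theorem isCompact_unitGroup :
    IsCompact (((valuation F).valuationSubring.unitGroup : Subgroup Fˣ) : Set Fˣ) := by
  have h1 : IsCompact {x : F | valuation F x = 1} := by
    refine (IsNonarchimedeanLocalField.isCompact_closedBall F 1).of_isClosed_subset ?_ ?_
    · simpa only [Valuation.restrict_eq_one_iff] using
        Valuation.isClosed_sphere (v := valuation F) 1
    · intro x hx
      exact le_of_eq hx
  rw [Units.isEmbedding_val₀.isCompact_iff]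
  convert h1 using 1
  ext x
  simp only [Set.mem_image, SetLike.mem_coe, Valuation.mem_unitGroup_iff, Set.mem_setOf_eq]
  constructor
  · rintro ⟨u, hu, rfl⟩
    exact hu
  · intro hx
    have hx0 : x ≠ 0 := by
      rintro rfl
      simp at hx
    exact ⟨Units.mk0 x hx0, hx, rfl⟩

variable {F}

/-- Finite intersections of norm groups are norm groups, given `isNormSubgroup_inf` and that
`⊤` is one. [folklore] -/
theorem IsNormSubgroup.finset_iInf (h₁ : isNormSubgroup_inf F) {ι : Type*} (u : Finset ι)
    (f : ι → Subgroup Fˣ) (hf : ∀ i ∈ u, IsNormSubgroup F (f i)) :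
    IsNormSubgroup F (⨅ i ∈ u, f i) := by
  classical
  induction u using Finset.induction_on with
  | empty => simpa using isNormSubgroup_top F
  | insert a s ha ih =>
    rw [Finset.iInf_insert]
    exact h₁ _ _ (hf a (Finset.mem_insert_self a s))
      (ih fun i hi => hf i (Finset.mem_insert_of_mem hi))

/-- Norm groups have finite index, given the fundamental equality
`index_normSubgroup_eq_finrank`. [folklore] -/
theorem IsNormSubgroup.finiteIndex (h₆ : index_normSubgroup_eq_finrank F) {U : Subgroup Fˣ}
    (hU : IsNormSubgroup F U) : U.FiniteIndex := by
  obtain ⟨E, hfd, hab, rfl⟩ := hU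
  refine ⟨?_⟩
  rw [h₆ E hfd hab]
  exact Module.finrank_pos.ne'

/-- Universal norms lie in every subgroup of finite index, given Serre's Prop. 6
(`D_F ⊆ (Fˣ)ⁿ` with `n` the index). [folklore] -/
theorem universalNormSubgroup_le_of_finiteIndex (h₃ : universalNormSubgroup_divisible_and_eq F)
    (U : Subgroup Fˣ) [U.FiniteIndex] : universalNormSubgroup F ≤ U := by
  intro x hx
  rw [h₃.2] at hx
  have hx' := (Subgroup.mem_iInf.mp ((Subgroup.mem_iInf.mp hx) U.index))
    (Nat.pos_of_ne_zero Subgroup.FiniteIndex.index_ne_zero)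
  obtain ⟨y, rfl⟩ := hx'
  exact U.pow_index_mem y

variable (F)

/-- **Reduction of the existence theorem to Serre's sub-results** (the proof of Serre LF XI §5
Thm. 2, pp. 174–175, specialised to `A_F = Fˣ`, `U_F = 𝒪ˣ`).  Given: norm groups are stable
under `⊓` (`h₁`) and over-groups (`h₂`), universal norms are `n`-th powers (`h₃`), norm groups
are closed (`h₄`), closed finite-index subgroups `⊇ 𝒪ˣ` are norm groups (`h₅`), and norm groups
have index = degree (`h₆`) — every open finite-index `U ≤ Fˣ` is a norm group.  Proof: `D_F ≤ U`
(`h₃`); the closed sets `N ∩ 𝒪ˣ` (`N` a norm group) meet the compact `𝒪ˣ ∖ U` in the empty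
set, so finitely many do, giving one norm group `N₀` (`h₁`) with `N₀ ∩ 𝒪ˣ ⊆ U`; then
`V = 𝒪ˣ · (N₀ ∩ U)` is closed of finite index (`h₄`, `h₆`) and contains `𝒪ˣ`, so is a norm
group (`h₅`); `N₀ ∩ V ⊆ U` elementwise, and `N₀ ∩ V` is a norm group (`h₁`), hence so is `U`
(`h₂`).
Ref: Serre, *Local Fields* (1979), Ch. XI §5, Thm. 2 (proof), Ch. XIV §6, Thm. 1.
[cite: SerreLocalFields1979, Ch. XI §5 Thm. 2] -/
theorem localExistenceTheorem_of (h₁ : isNormSubgroup_inf F) (h₂ : isNormSubgroup_of_le F)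
    (h₃ : universalNormSubgroup_divisible_and_eq F) (h₄ : isClosed_of_isNormSubgroup F)
    (h₅ : isNormSubgroup_of_unitGroup_le F) (h₆ : index_normSubgroup_eq_finrank F) :
    localExistenceTheorem F := by
  intro U hU hUfi
  classical
  set OU : Subgroup Fˣ := (valuation F).valuationSubring.unitGroup with hOU_def
  -- Step 1: universal norms lie in `U`.
  have hDU : universalNormSubgroup F ≤ U := universalNormSubgroup_le_of_finiteIndex h₃ U
  -- Step 2: compactness of `𝒪ˣ ∖ U` against the closed norm groups.
  have hs : IsCompact ((OU : Set Fˣ) ∩ (U : Set Fˣ)ᶜ) :=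
    (isCompact_unitGroup F).inter_right hU.isClosed_compl
  obtain ⟨u, hu⟩ := hs.elim_finite_subfamily_closed
    (fun i : {N : Subgroup Fˣ // IsNormSubgroup F N} => ((i.1 : Subgroup Fˣ) : Set Fˣ))
    (fun i => h₄ i.1 i.2) (by
      rw [Set.eq_empty_iff_forall_notMem]
      rintro x ⟨⟨-, hxU⟩, hxN⟩
      refine hxU (hDU ((mem_universalNormSubgroup_iff F x).mpr fun N hN => ?_))
      exact Set.mem_iInter.mp hxN ⟨N, hN⟩)
  set N₀ : Subgroup Fˣ :=
    ⨅ i ∈ u, ((i : {N : Subgroup Fˣ // IsNormSubgroup F N}).1 : Subgroup Fˣ) with hN₀_def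
  have hN₀ : IsNormSubgroup F N₀ := IsNormSubgroup.finset_iInf h₁ u _ fun i _ => i.2
  have hN₀U : ∀ x ∈ N₀, x ∈ OU → x ∈ U := by
    intro x hxN hxO
    by_contra hxU
    have hx : x ∈ ((OU : Set Fˣ) ∩ (U : Set Fˣ)ᶜ) ∩
        ⋂ i ∈ u, (((i : {N : Subgroup Fˣ // IsNormSubgroup F N}).1 : Subgroup Fˣ) : Set Fˣ) := by
      refine ⟨⟨hxO, hxU⟩, Set.mem_iInter₂.mpr fun i hi => ?_⟩
      exact (Subgroup.mem_iInf.mp ((Subgroup.mem_iInf.mp hxN) i)) hi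
    rw [hu] at hx
    exact hx
  haveI hN₀fi : N₀.FiniteIndex := hN₀.finiteIndex h₆
  -- Step 3: `V = 𝒪ˣ · (N₀ ∩ U)` is a closed finite-index subgroup containing the units.
  set V : Subgroup Fˣ := OU ⊔ (N₀ ⊓ U) with hV_def
  have hNU_closed : IsClosed ((N₀ ⊓ U : Subgroup Fˣ) : Set Fˣ) := by
    rw [Subgroup.coe_inf]
    exact (h₄ N₀ hN₀).inter (U.isClosed_of_isOpen hU)
  have hNU_open : IsOpen ((N₀ ⊓ U : Subgroup Fˣ) : Set Fˣ) :=
    Subgroup.isOpen_of_isClosed_of_finiteIndex _ hNU_closed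
  have hV_open : IsOpen (V : Set Fˣ) := Subgroup.isOpen_mono le_sup_right hNU_open
  have hV_closed : IsClosed (V : Set Fˣ) := V.isClosed_of_isOpen hV_open
  haveI hVfi : V.FiniteIndex := Subgroup.finiteIndex_of_le (le_sup_right : N₀ ⊓ U ≤ V)
  have hV : IsNormSubgroup F V := h₅ V hV_closed hVfi le_sup_left
  -- Step 4: `N₀ ∩ V ≤ U`, and `N₀ ∩ V` is a norm group.
  have hle : N₀ ⊓ V ≤ U := by
    intro x hx
    obtain ⟨hxN, hxV⟩ := Subgroup.mem_inf.mp hx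
    obtain ⟨y, hy, z, hz, rfl⟩ := Subgroup.mem_sup.mp hxV
    obtain ⟨hzN, hzU⟩ := Subgroup.mem_inf.mp hz
    have hyN : y ∈ N₀ := by
      simpa using N₀.mul_mem hxN (N₀.inv_mem hzN)
    exact U.mul_mem (hN₀U y hyN hy) hzU
  exact h₂ _ _ (h₁ _ _ hN₀ hV) hle

/-- The trunk predicate `exists_intermediateField_normSubgroup_eq F` for a non-archimedean
local field `F`, reduced to the same six sub-results (it is definitionally
`localExistenceTheorem F`). [cite: SerreLocalFields1979, Ch. XIV §6 Thm. 1] -/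
theorem exists_intermediateField_normSubgroup_eq_of (h₁ : isNormSubgroup_inf F)
    (h₂ : isNormSubgroup_of_le F) (h₃ : universalNormSubgroup_divisible_and_eq F)
    (h₄ : isClosed_of_isNormSubgroup F) (h₅ : isNormSubgroup_of_unitGroup_le F)
    (h₆ : index_normSubgroup_eq_finrank F) :
    exists_intermediateField_normSubgroup_eq F :=
  localExistenceTheorem_of F h₁ h₂ h₃ h₄ h₅ h₆

end Assembly

end Literature.NumberTheory.GaloisRepresentations
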